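import Summits.CriticalPhenomena.PercolationContinuityZ3.Theorems.PercNearOneGluingNoHeavyLowerTailSunflowerLocalAssignment
import HarnessLib
import HarnessLib.Audit

/-!
# `NoHeavyLowerTail` (crux stmt-CriticalPhenomena-4575), abstract sunflower cubic: the typed conjecture `LocalRainbowAssignment`
# (LOCAL MATROID PARTITION of the rainbows — independence required only cube by cube) and the reduction to ★

Support file (seat `prim-l12-p2` gen 24; `--supports stmt-CriticalPhenomena-4575`).  No `sorry`.  One new definition: the `@[conjecture]`
`LocalRainbowAssignment` (an obligation of this programme — census-true, unproved —, never a fact).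
Memo: run/shared/lean/prim/prim-l12/prim-l12-p2/FINDING-g24-LOCAL-ASSIGNMENT.md (§1).

SETTING (`…SunflowerLocalAssignment`, gen 24).  ★ (`PartitionLemmaH`) reads `#rainbows ≤ Σ_{lab S ∈ {0,4}} cubeSlack Sᶜ`; the two-stage vector
`rbVec ρ` restricted to the supplies with spectator block `S` lies in the kernel of the spectator rows of the ONE cube `Sᶜ`, whose nullity is
`cubeSlack Sᶜ` (`card_le_cubeSlack_of_blockIndependent`).  Hence (`ZH_nonneg_of_blockAssignment`) ★ follows for a sunflower as soon as its
rainbows can be distributed over the spectator blocks so that EACH FIBRE IS INDEPENDENT INSIDE ITS OWN CUBE.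

* `LocalRainbowAssignment` (LMP, typed conjecture, NEW): such a distribution exists for every sunflower.  It is implied by
  `RainbowKernelIndependence` and by `RainbowMatroidPartition` (generalised Laplace expansion of a nonzero maximal minor along the block
  columns), and it is the WEAKEST statement of the GF(2) programme that still gives ★ by counting: by Rado's theorem it says
  `#X ≤ Σ_S rank{rbVec ρ|_S : ρ ∈ X}` for every set `X` of rainbows (the direct sum of the per-cube linear matroids), whereas MP needs the two
  global ranks.  Its content is LOCAL: at a bottom block `S` the fibre must consist of rainbows with distinct `Q1` whose `(1|4)`-kernel vectors
  `ν_{Q1}` of the cube `Sᶜ` are independent (an even-family condition, gen 23 memo §4); at a kernel block, distinct `Q3` with independent `μ_{Q3}`.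
  CENSUS (gen 24, exact matroid intersection `code/lmp.c`, fixed petal order): an assignment exists in EVERY instance tested — n ≤ 4 exhaustive (780
  sunflowers with rainbows), 2·10⁴ random sunflowers on 5–6 points, 5 000 'hard' (all petals non-intersecting) on 6–7 points, the doubled star;
  moreover kernel blocks are needed only at `K = Q1 ∪ D` with `D ⊆ Q2` MINIMAL such that `Q1 ∪ D` is kernel and `Q2 ∖ D` is bottom (`lmp3.c`, FAM=258,
  0 failures), while the bottom side needs non-maximal slots.  Sufficient criteria proved: `…SunflowerLocalAssignment` (rival-free slots, private
  supplies), `…SunflowerLocalAssignmentExact` (junk-free slots: 599/600 hard instances on 7 points).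
* `partitionLemmaH_of_localRainbowAssignment : LocalRainbowAssignment → PartitionLemmaH`.
-/

namespace Summit.CriticalPhenomena.PercolationContinuityZ3.Theorems.SunflowerPartition

open Finset

/-- **LOCAL RAINBOW ASSIGNMENT / LOCAL MATROID PARTITION** (LMP; this work; OPEN, census-clean — see the file header): for every sunflower
there is a map `f` from the rainbows to spectator blocks (`lab (f ρ) ∈ {4, 0}`) such that for every block `S` the two-stage vectors of the
rainbows sent to `S`, restricted to the supplies with spectator `S`, are linearly independent over `GF(2)`.  Implied by
`RainbowKernelIndependence` and by `RainbowMatroidPartition`; implies ★.  An obligation, never a fact: use as `(h : LocalRainbowAssignment)`.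
[status: open] -/
@[conjecture] def LocalRainbowAssignment : Prop :=
  ∀ (α : Type) [Fintype α] [DecidableEq α] (F : Sunflower α),
    ∃ f : Finset α × Finset α → Finset α,
      (∀ ρ ∈ F.dem.filter (fun d => F.IsRainbow d), F.lab (f ρ) = 4 ∨ F.lab (f ρ) = 0) ∧
      ∀ S : Finset α, (F.lab S = 4 ∨ F.lab S = 0) → LinearIndependent (ZMod 2)
        (fun ρ : ↥((F.dem.filter (fun d => F.IsRainbow d)).filter (fun ρ => f ρ = S)) =>
          fun σ : ↥(F.sup.filter (fun σ => σ.2 = S)) => F.rbVec ρ.1 σ.1)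

/-- **LMP ⟹ ★** (this work): `ZH_nonneg_of_blockAssignment` for every sunflower. [this work] -/
theorem partitionLemmaH_of_localRainbowAssignment (h : LocalRainbowAssignment) : PartitionLemmaH := by
  intro α _ _ F
  obtain ⟨f, hf, hind⟩ := h α F
  exact F.ZH_nonneg_of_blockAssignment f hf hind

end Summit.CriticalPhenomena.PercolationContinuityZ3.Theorems.SunflowerPartition
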